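import Literature.NumberTheory.Automorphic.SatakeParameterTrivialBound
import Literature.NumberTheory.Automorphic.AutomorphicGLn
import HarnessLib

/-!
# Satake families bounded by one: the Jacquet–Shalika facts under the Ramanujan bound, and
unconditionally in rank `≤ 1`

Trunk `AutomorphicAxiomatic` (G19), topic `NumberTheory/Automorphic`; namespace `Literature.Automorphic`.
Companion to `AutomorphicLFunction` / `AutomorphicLFunctionProofs` / `JacquetShalikaEulerProducts` /
`SatakeParameterTrivialBound`.

The named facts of the Jacquet–Shalika cluster — `StandardLFunctionData.multipliable_L`,
`multipliable_partialStandardL`, `absolutelyConvergent_partialStandardL`,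
`norm_satakeParameter_le_sqrt` ((5.1.3)), `summable_normSq_trace_satakePow` ((5.3.3)–(5.3.4)),
`L_eq_partialStandardL_mul` and `JacquetShalika1981_continuation_partialPairL_conj` (Lemma (5.2)) —
rest, after `SatakeParameterTrivialBound`, on the single input Lemma (5.2) (the Rankin–Selberg
continuation of `L_S(s, π × π̄)` to `re s > 1`). This file records the two situations in which the
whole cluster is *elementary*, and proves it there with no named input:

1. **Under the unit bound `|a| ≤ 1`** on the Hecke–Satake parameters off the exceptional set (in
   particular under clause (i) of the Ramanujan conjecture `Literature.Lang.RamanujanConjectureGL n` of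
   `AutomorphicGLn`, `|a| = 1`): then `|tr A_v^k|² ≤ n²`, the series (5.3.3) is dominated by
   `n² ∑_v ∑_k q_v^{-kσ}` and converges for `σ > 1` (the case `B = 0` of the `_of_rpow` lemmas of
   `SatakeParameterTrivialBound`), the partial Euler products of `L(s, Π)` and of `L_S(s, Π × Π̄)`
   converge absolutely on `re s > 1`, and the latter is holomorphic there, being `exp` of an
   `L`-series inside its half-plane of absolute convergence — so it is its own continuation and the
   conclusion of Lemma (5.2) holds with `S₀ = ∅`. Headline: `StandardLFunctionData.multipliable_L_of_ramanujan`,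
   `continuation_partialPairL_conj_of_ramanujan` (Ramanujan ⟹ Jacquet–Shalika, the trivial
   direction; the converse direction "(5.3.3) ⟹ `|a| ≤ q_v^{1/2}`" is
   `norm_le_sqrt_of_summable_normSq_trace` of `SatakeParameterTrivialBound`).

2. **Unconditionally in rank `n ≤ 1`.** For `n ≤ 1` the group `GL_n(𝔸_K)` is commutative, so for
   every level `Kf` and every `g` the double coset `Kf g Kf` is the single coset `g Kf`
   (`orbit_mk_eq_singleton_of_subsingleton`) and the Hecke operator `[Kf g Kf]` acts on `Kf`-fixed
   vectors of `W ≤ L²(GL_n(K) A_G \ GL_n(𝔸_K))` as the single translation `R(g)`, an isometry; hence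
   every Hecke eigenvalue, in particular the Hecke–Satake parameter `a` recorded by
   `HasSatakeParameterAt` (`T_{v,1} f = q_v^0 e_1({a}) f = a f`; for `n = 1` this is the value at
   `ϖ_v`, up to the inversion built into the `rightRegular` convention, of the local component of
   the Hecke character `Π = χ`), has `|a| = 1`
   (`norm_eq_one_of_hasSatakeParameterAt_of_le_one`: clause (i) of the Ramanujan conjecture in rank
   `≤ 1`, `ramanujan_bound_of_le_one`). Consequently **all seven named facts above hold for `n ≤ 1`
   with genuine proofs** (`StandardLFunctionData.multipliable_L_of_le_one`, …,
   `continuation_partialPairL_conj_of_le_one`): the absolute convergence on `re s > 1` of the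
   Hecke `L`-functions `L(s, χ) = ∏_v (1 - χ_v(ϖ_v) q_v^{-s})⁻¹` of the unitary characters `χ` of
   `𝔸_K^× / K^× ℝ_{>0}` (classical: Hecke; Tate's thesis), over the tree's honest
   `L²`/Hecke-operator definitions. (`n = 0` is the degenerate case of empty parameters.)

Nothing here restates or weakens a named fact: every `_of_norm_le_one` / `_of_ramanujan` /
`_of_le_one` theorem concludes the pre-existing `Prop` literally. No `Prop`-valued definitions are
introduced; the unit bound is spelled out as the hypothesis
`∀ P S α, IsSatakeFamilyOf P S α → ∀ v ∉ S, ∀ a ∈ α v, ‖a‖ ≤ 1`.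

## Main statements

* `summable_normSq_trace_of_norm_le_one`, `summable_norm_inv_eulerFactor_sub_one_of_norm_le_one`,
  `multipliable_inv_eulerFactor_of_norm_le_one`, `abscissaOfAbsConv_normSqTraceSeries_le_one`,
  `partialPairL_conjFamily_eq_exp_LSeries_of_norm_le_one`,
  `differentiableOn_partialPairL_conjFamily_of_norm_le_one` (pure analysis of unit-bounded
  families, all proved);
* `absolutelyConvergent_partialStandardL_of_norm_le_one`, `multipliable_partialStandardL_of_norm_le_one`,
  `summable_normSq_trace_satakePow_of_norm_le_one`, `norm_satakeParameter_le_sqrt_of_norm_le_one`,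
  `continuation_partialPairL_conj_of_norm_le_one`, `StandardLFunctionData.multipliable_L_of_norm_le_one`,
  `StandardLFunctionData.L_eq_partialStandardL_mul_of_norm_le_one` (the named facts under the unit
  bound, proved);
* `IsSatakeFamilyOf.norm_eq_one_of_ramanujan` and the `_of_ramanujan` family (the named facts
  under `Literature.Lang.RamanujanConjectureGL n`, proved implications);
* `gl_mul_comm_of_subsingleton`, `orbit_mk_eq_singleton_of_subsingleton`,
  `norm_eq_one_of_heckeOperatorAt_apply_eq_smul`, `norm_eq_one_of_hasSatakeParameterAt_of_le_one`,
  `ramanujan_bound_of_le_one`, `IsSatakeFamilyOf.norm_eq_one_of_le_one` (rank `≤ 1`, proved);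
* `StandardLFunctionData.multipliable_L_of_le_one`, `multipliable_partialStandardL_of_le_one`,
  `absolutelyConvergent_partialStandardL_of_le_one`, `summable_normSq_trace_satakePow_of_le_one`,
  `norm_satakeParameter_le_sqrt_of_le_one`, `continuation_partialPairL_conj_of_le_one`,
  `StandardLFunctionData.L_eq_partialStandardL_mul_of_le_one` (**the named facts for `n ≤ 1`,
  proved unconditionally**).

## References

* H. Jacquet, J. A. Shalika, *On Euler products and the classification of automorphic
  representations I*, Amer. J. Math. 103 (1981), 499–558: Thm. (5.3), Lemma (5.2), (5.1.3),
  (5.3.3).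
* J. Tate, *Fourier analysis in number fields and Hecke's zeta-functions*, in Cassels–Fröhlich,
  *Algebraic Number Theory* (1967), Ch. XV (Hecke `L`-functions of idele class characters).
* P. Sarnak, *Notes on the generalized Ramanujan conjectures*, Clay Math. Proc. 4 (2005).
-/

noncomputable section

open scoped MatrixGroups ComplexConjugate Valued
open NumberField IsDedekindDomain MeasureTheory Complex

namespace Literature.NumberTheory.Automorphic

/-! ### Analytic consequences of the unit bound `‖a‖ ≤ 1` -/

section UnitBoundSeries

variable {K : Type} [Field K] [NumberField K]

/-- The unit bound `‖a‖ ≤ 1` is the bound `‖a‖ ≤ q_v^B` with `B = 0`. [folklore] -/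
theorem norm_le_rpow_zero_of_norm_le_one {S : Set (HeightOneSpectrum (𝓞 K))} {α : SatakeFamily K}
    (hb : ∀ v ∉ S, ∀ a ∈ α v, ‖a‖ ≤ 1) :
    ∀ v ∉ S, ∀ a ∈ α v, ‖a‖ ≤ (v.residueCard : ℝ) ^ (0 : ℝ) := fun v hv a ha => by
  rw [Real.rpow_zero]
  exact hb v hv a ha

/-- The unit bound `‖a‖ ≤ 1` implies the Jacquet–Shalika bound `‖a‖ ≤ q_v^{1/2}` (`q_v ≥ 2`).
[folklore] -/
theorem norm_le_sqrt_of_norm_le_one {S : Set (HeightOneSpectrum (𝓞 K))} {α : SatakeFamily K}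
    (hb : ∀ v ∉ S, ∀ a ∈ α v, ‖a‖ ≤ 1) :
    ∀ v ∉ S, ∀ a ∈ α v, ‖a‖ ≤ Real.sqrt v.residueCard := fun v hv a ha => by
  refine (hb v hv a ha).trans ?_
  rw [Real.one_le_sqrt]
  exact_mod_cast v.one_lt_residueCard.le

/-- **(5.3.3) for `σ > 1` under the unit bound:** if `‖a‖ ≤ 1` for all `a ∈ α v`, `v ∉ S`, and
`card (α v) ≤ n`, then `∑_{v ∉ S} ∑_k |tr A_v^k|² / (k q_v^{kσ}) < ∞` for every `σ > 1`
(`|tr A_v^k|² ≤ n²`, comparison with `n² ∑_v ∑_k q_v^{-kσ}`; the case `B = 0` of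
`summable_jsCoeff_mul_rpow_neg_of_rpow`). [folklore] -/
theorem summable_normSq_trace_of_norm_le_one {S : Set (HeightOneSpectrum (𝓞 K))}
    {α : SatakeFamily K} {n : ℕ} (hb : ∀ v ∉ S, ∀ a ∈ α v, ‖a‖ ≤ 1)
    (hcard : ∀ v ∉ S, Multiset.card (α v) ≤ n) {σ : ℝ} (hσ : 1 < σ) :
    Summable fun kv : ℕ × {v : HeightOneSpectrum (𝓞 K) // v ∉ S} =>
      ‖((α kv.2.1).map (· ^ (kv.1 + 1))).sum‖ ^ 2 /
        ((kv.1 + 1 : ℝ) * (kv.2.1.residueCard : ℝ) ^ ((kv.1 + 1 : ℝ) * σ)) :=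
  (summable_jsCoeff_mul_rpow_neg_of_rpow (norm_le_rpow_zero_of_norm_le_one hb) hcard
    (by linarith : 2 * (0 : ℝ) + 1 < σ)).congr fun i => jsCoeff_mul_rpow_neg S α σ i

/-- **Absolute convergence of the partial standard Euler product on `re s > 1` under the unit
bound** (`∑_{v ∉ S} ‖L(s, α v) - 1‖ < ∞`; from `summable_norm_inv_eulerFactor_sub_one` of
`JacquetShalikaEulerProducts` fed with `summable_normSq_trace_of_norm_le_one`; directly this is the
comparison `‖∏_{a ∈ α v} (1 - a q_v^{-s}) - 1‖ ≤ (2^n - 1) q_v^{-σ}` with `∑_v q_v^{-σ} < ∞`).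
[folklore] -/
theorem summable_norm_inv_eulerFactor_sub_one_of_norm_le_one {S : Set (HeightOneSpectrum (𝓞 K))}
    {α : SatakeFamily K} {n : ℕ} (hb : ∀ v ∉ S, ∀ a ∈ α v, ‖a‖ ≤ 1)
    (hcard : ∀ v ∉ S, Multiset.card (α v) ≤ n) {s : ℂ} (hs : 1 < s.re) :
    Summable fun v : {v : HeightOneSpectrum (𝓞 K) // v ∉ S} =>
      ‖((eulerPolynomial (α v.1)).eval ((v.1.residueCard : ℂ) ^ (-s)))⁻¹ - 1‖ :=
  summable_norm_inv_eulerFactor_sub_one (norm_le_sqrt_of_norm_le_one hb) hcard hs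
    (summable_normSq_trace_of_norm_le_one hb hcard hs)

/-- Hence the partial standard Euler product is multipliable on `re s > 1` under the unit bound.
[folklore] -/
theorem multipliable_inv_eulerFactor_of_norm_le_one {S : Set (HeightOneSpectrum (𝓞 K))}
    {α : SatakeFamily K} {n : ℕ} (hb : ∀ v ∉ S, ∀ a ∈ α v, ‖a‖ ≤ 1)
    (hcard : ∀ v ∉ S, Multiset.card (α v) ≤ n) {s : ℂ} (hs : 1 < s.re) :
    Multipliable fun v : {v : HeightOneSpectrum (𝓞 K) // v ∉ S} =>
      ((eulerPolynomial (α v.1)).eval ((v.1.residueCard : ℂ) ^ (-s)))⁻¹ :=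
  multipliable_inv_eulerFactor (norm_le_sqrt_of_norm_le_one hb) hcard hs
    (summable_normSq_trace_of_norm_le_one hb hcard hs)

/-- Under the unit bound the Dirichlet series (5.3.3) over `ℕ` has abscissa of absolute
convergence `≤ 1` (case `B = 0` of `abscissaOfAbsConv_normSqTraceSeries_le_of_rpow`). [folklore] -/
theorem abscissaOfAbsConv_normSqTraceSeries_le_one {S : Set (HeightOneSpectrum (𝓞 K))}
    {α : SatakeFamily K} {n : ℕ} (hb : ∀ v ∉ S, ∀ a ∈ α v, ‖a‖ ≤ 1)
    (hcard : ∀ v ∉ S, Multiset.card (α v) ≤ n) :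
    LSeries.abscissaOfAbsConv (normSqTraceSeries S α) ≤ (1 : ℝ) := by
  have h := abscissaOfAbsConv_normSqTraceSeries_le_of_rpow (norm_le_rpow_zero_of_norm_le_one hb)
    hcard
  norm_num at h
  exact h

/-- **`L_S(s, α × ᾱ) = exp f(s)` on `re s > 1` under the unit bound** (case `B = 0` of
`partialPairL_conjFamily_eq_exp_LSeries_of_rpow`). [folklore] -/
theorem partialPairL_conjFamily_eq_exp_LSeries_of_norm_le_one {S : Set (HeightOneSpectrum (𝓞 K))}
    {α : SatakeFamily K} {n : ℕ} (hb : ∀ v ∉ S, ∀ a ∈ α v, ‖a‖ ≤ 1)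
    (hcard : ∀ v ∉ S, Multiset.card (α v) ≤ n) {s : ℂ} (hs : 1 < s.re) :
    partialPairL S α (conjFamily α) s = Complex.exp (LSeries (normSqTraceSeries S α) s) :=
  partialPairL_conjFamily_eq_exp_LSeries_of_rpow (norm_le_rpow_zero_of_norm_le_one hb) hcard
    (by linarith)

/-- **Under the unit bound `L_S(s, α × ᾱ)` is holomorphic on `re s > 1`** (it is
`exp ∘ LSeries a` there, and an `L`-series is holomorphic on its half-plane of absolute convergence,
Mathlib `LSeries_differentiableOn`). This is the conclusion of Jacquet–Shalika's Lemma (5.2) for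
such families, with the Euler product itself as the continuation. [folklore] -/
theorem differentiableOn_partialPairL_conjFamily_of_norm_le_one
    {S : Set (HeightOneSpectrum (𝓞 K))} {α : SatakeFamily K} {n : ℕ}
    (hb : ∀ v ∉ S, ∀ a ∈ α v, ‖a‖ ≤ 1) (hcard : ∀ v ∉ S, Multiset.card (α v) ≤ n) :
    DifferentiableOn ℂ (partialPairL S α (conjFamily α)) {s : ℂ | 1 < s.re} := by
  have hd : DifferentiableOn ℂ (fun s => Complex.exp (LSeries (normSqTraceSeries S α) s))
      {s : ℂ | 1 < s.re} := by
    refine ((LSeries_differentiableOn _).mono fun s hs => ?_).cexp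
    exact lt_of_le_of_lt (abscissaOfAbsConv_normSqTraceSeries_le_one hb hcard)
      (by exact_mod_cast hs)
  exact hd.congr fun s hs => partialPairL_conjFamily_eq_exp_LSeries_of_norm_le_one hb hcard hs

end UnitBoundSeries

/-! ### The named facts of the Jacquet–Shalika cluster under the unit bound -/

section UnitBoundCuspidal

variable {n : ℕ} {K : Type} [Field K] [NumberField K]
  {μ : Measure (AdelicGroupData.gl n K).automorphicQuotient}
  [(AdelicGroupData.gl n K).IsAutomorphicMeasure μ]

/-- **`absolutelyConvergent_partialStandardL` under the unit bound.** If every Satake family of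
every cuspidal `Π` (for the level structure at hand) is bounded by `1` off its exceptional set,
then `∑_{v ∉ S} ‖L(s, Π_v) - 1‖ < ∞` on `re s > 1` (the named fact of
`AutomorphicLFunctionProofs`, literally). [folklore] -/
theorem absolutelyConvergent_partialStandardL_of_norm_le_one
    (h : ∀ (P : CuspidalAutomorphicRepGL n K μ) ⦃S : Set (HeightOneSpectrum (𝓞 K))⦄
      ⦃α : SatakeFamily K⦄, IsSatakeFamilyOf P S α → ∀ v ∉ S, ∀ a ∈ α v, ‖a‖ ≤ 1) :
    absolutelyConvergent_partialStandardL (μ := μ) :=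
  fun P _ _ hα _ hs => summable_norm_inv_eulerFactor_sub_one_of_norm_le_one (h P hα)
    (fun _ hv => (hα.card_eq hv).le) hs

/-- **`multipliable_partialStandardL` under the unit bound** (via
`multipliable_partialStandardL_of_absolutelyConvergent`). [folklore] -/
theorem multipliable_partialStandardL_of_norm_le_one
    (h : ∀ (P : CuspidalAutomorphicRepGL n K μ) ⦃S : Set (HeightOneSpectrum (𝓞 K))⦄
      ⦃α : SatakeFamily K⦄, IsSatakeFamilyOf P S α → ∀ v ∉ S, ∀ a ∈ α v, ‖a‖ ≤ 1) :
    multipliable_partialStandardL (μ := μ) :=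
  multipliable_partialStandardL_of_absolutelyConvergent
    (absolutelyConvergent_partialStandardL_of_norm_le_one h)

/-- **`summable_normSq_trace_satakePow` ((5.3.3)–(5.3.4)) under the unit bound**, literally the
named fact of `AutomorphicLFunctionProofs`. [folklore] -/
theorem summable_normSq_trace_satakePow_of_norm_le_one
    (h : ∀ (P : CuspidalAutomorphicRepGL n K μ) ⦃S : Set (HeightOneSpectrum (𝓞 K))⦄
      ⦃α : SatakeFamily K⦄, IsSatakeFamilyOf P S α → ∀ v ∉ S, ∀ a ∈ α v, ‖a‖ ≤ 1) :
    summable_normSq_trace_satakePow (μ := μ) :=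
  fun P _ _ hα _ hσ => summable_normSq_trace_of_norm_le_one (h P hα)
    (fun _ hv => (hα.card_eq hv).le) hσ

/-- **`norm_satakeParameter_le_sqrt` ((5.1.3)) under the unit bound** (`1 ≤ q_v^{1/2}`).
[folklore] -/
theorem norm_satakeParameter_le_sqrt_of_norm_le_one
    (h : ∀ (P : CuspidalAutomorphicRepGL n K μ) ⦃S : Set (HeightOneSpectrum (𝓞 K))⦄
      ⦃α : SatakeFamily K⦄, IsSatakeFamilyOf P S α → ∀ v ∉ S, ∀ a ∈ α v, ‖a‖ ≤ 1) :
    norm_satakeParameter_le_sqrt (μ := μ) :=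
  fun P _ _ hα _ hv _ ha => norm_le_sqrt_of_norm_le_one (h P hα) _ hv _ ha

/-- **The conclusion of Jacquet–Shalika's Lemma (5.2) under the unit bound:** the named fact
`JacquetShalika1981_continuation_partialPairL_conj` holds with `S₀ = ∅`, the continuation being
the Euler product `L_S(s, α × ᾱ)` itself, holomorphic on `re s > 1`
(`differentiableOn_partialPairL_conjFamily_of_norm_le_one`), and `x₀ = 1`. [folklore] -/
theorem continuation_partialPairL_conj_of_norm_le_one
    (h : ∀ (P : CuspidalAutomorphicRepGL n K μ) ⦃S : Set (HeightOneSpectrum (𝓞 K))⦄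
      ⦃α : SatakeFamily K⦄, IsSatakeFamilyOf P S α → ∀ v ∉ S, ∀ a ∈ α v, ‖a‖ ≤ 1) :
    JacquetShalika1981_continuation_partialPairL_conj (μ := μ) :=
  fun P => ⟨∅, fun S α _ hα => ⟨partialPairL ↑S α (conjFamily α), 1,
    differentiableOn_partialPairL_conjFamily_of_norm_le_one (h P hα)
      (fun _ hv => (hα.card_eq hv).le), fun _ _ => rfl⟩⟩

/-- **`multipliable_L` under the unit bound for the Satake families of `Π`:** the full Euler
product of every standard `L`-function datum of `Π` is multipliable on `re s > 1` (the named fact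
`StandardLFunctionData.multipliable_L`, literally; the finitely many factors at `v ∈ D.S` do not
affect multipliability). Only the families of the one representation `Π` enter. [folklore] -/
theorem StandardLFunctionData.multipliable_L_of_norm_le_one {P : CuspidalAutomorphicRepGL n K μ}
    (h : ∀ ⦃S : Set (HeightOneSpectrum (𝓞 K))⦄ ⦃α : SatakeFamily K⦄, IsSatakeFamilyOf P S α →
      ∀ v ∉ S, ∀ a ∈ α v, ‖a‖ ≤ 1) :
    StandardLFunctionData.multipliable_L (P := P) := by
  intro D s hs
  refine Multipliable.mul_compl (s := (↑D.S : Set (HeightOneSpectrum (𝓞 K))))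
    (D.S.multipliable _) ?_
  refine (multipliable_inv_eulerFactor_of_norm_le_one (h D.isSatakeFamily)
    (fun v hv => (D.isSatakeFamily.card_eq hv).le) hs).congr fun v => ?_
  simp only [Function.comp_apply, D.localFactor_of_not_mem v.1 (by simpa using v.2)]

/-- **`L_eq_partialStandardL_mul` under the unit bound** (via
`StandardLFunctionData.L_eq_partialStandardL_mul_of_multipliable_partialStandardL`). [folklore] -/
theorem StandardLFunctionData.L_eq_partialStandardL_mul_of_norm_le_one
    {P : CuspidalAutomorphicRepGL n K μ}
    (h : ∀ (P : CuspidalAutomorphicRepGL n K μ) ⦃S : Set (HeightOneSpectrum (𝓞 K))⦄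
      ⦃α : SatakeFamily K⦄, IsSatakeFamilyOf P S α → ∀ v ∉ S, ∀ a ∈ α v, ‖a‖ ≤ 1) :
    StandardLFunctionData.L_eq_partialStandardL_mul (P := P) :=
  StandardLFunctionData.L_eq_partialStandardL_mul_of_multipliable_partialStandardL
    (multipliable_partialStandardL_of_norm_le_one h)

end UnitBoundCuspidal

/-! ### Under the Ramanujan conjecture -/

section Ramanujan

variable {n : ℕ} {K : Type} [Field K] [NumberField K]
  {μ : Measure (AdelicGroupData.gl n K).automorphicQuotient}
  [(AdelicGroupData.gl n K).IsAutomorphicMeasure μ]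

/-- **Ramanujan gives the unit bound for Satake families:** under `RamanujanConjectureGL n`
(clause (i): `|a| = 1` for the Satake parameters at any level maximal at `v`), every member of a
Satake family of a cuspidal `Π` off `S` has absolute value `1` (`IsSatakeFamilyOf` records Satake
parameters at principal congruence levels `K(𝔫)`, `v ∤ 𝔫 ≠ 0`, which are maximal at `v`,
`isMaximalAt_principalCongruenceLevel`). [folklore] -/
theorem IsSatakeFamilyOf.norm_eq_one_of_ramanujan (hR : Literature.NumberTheory.Automorphic.RamanujanConjectureGL n)
    {P : CuspidalAutomorphicRepGL n K μ} {S : Set (HeightOneSpectrum (𝓞 K))} {α : SatakeFamily K}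
    (hα : IsSatakeFamilyOf P S α) {v : HeightOneSpectrum (𝓞 K)} (hv : v ∉ S) {a : ℂ}
    (ha : a ∈ α v) : ‖a‖ = 1 := by
  obtain ⟨𝔫, h𝔫, hv𝔫, ϖ, hsat⟩ := hα v hv
  exact (hR K μ P).1 _ v ϖ (α v) (isMaximalAt_principalCongruenceLevel n K v h𝔫 hv𝔫) hsat a ha

/-- Under `RamanujanConjectureGL n`, all Satake families of all cuspidal `Π` of `GL_n(𝔸_K)`
satisfy the unit bound. [folklore] -/
theorem norm_le_one_of_ramanujan (hR : Literature.NumberTheory.Automorphic.RamanujanConjectureGL n) :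
    ∀ (P : CuspidalAutomorphicRepGL n K μ) ⦃S : Set (HeightOneSpectrum (𝓞 K))⦄
      ⦃α : SatakeFamily K⦄, IsSatakeFamilyOf P S α → ∀ v ∉ S, ∀ a ∈ α v, ‖a‖ ≤ 1 :=
  fun _ _ _ hα _ hv _ ha => (hα.norm_eq_one_of_ramanujan hR hv ha).le

/-- **Ramanujan implies `multipliable_L`** (absolute convergence of `L(s, Π)` on `re s > 1`,
Jacquet–Shalika's Thm. (5.3), for every cuspidal `Π` of `GL_n(𝔸_K)`), trivially: under `|a| = 1`
the Euler product is dominated by `ζ_K(σ)^n`. [folklore] -/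
theorem StandardLFunctionData.multipliable_L_of_ramanujan (hR : Literature.NumberTheory.Automorphic.RamanujanConjectureGL n)
    {P : CuspidalAutomorphicRepGL n K μ} : StandardLFunctionData.multipliable_L (P := P) :=
  StandardLFunctionData.multipliable_L_of_norm_le_one fun _ _ hα =>
    norm_le_one_of_ramanujan hR P hα

/-- Ramanujan implies `multipliable_partialStandardL`. [folklore] -/
theorem multipliable_partialStandardL_of_ramanujan (hR : Literature.NumberTheory.Automorphic.RamanujanConjectureGL n) :
    multipliable_partialStandardL (μ := μ) :=
  multipliable_partialStandardL_of_norm_le_one (norm_le_one_of_ramanujan hR)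

/-- Ramanujan implies `absolutelyConvergent_partialStandardL`. [folklore] -/
theorem absolutelyConvergent_partialStandardL_of_ramanujan
    (hR : Literature.NumberTheory.Automorphic.RamanujanConjectureGL n) :
    absolutelyConvergent_partialStandardL (μ := μ) :=
  absolutelyConvergent_partialStandardL_of_norm_le_one (norm_le_one_of_ramanujan hR)

/-- Ramanujan implies (5.3.3)–(5.3.4) (`summable_normSq_trace_satakePow`). [folklore] -/
theorem summable_normSq_trace_satakePow_of_ramanujan (hR : Literature.NumberTheory.Automorphic.RamanujanConjectureGL n) :
    summable_normSq_trace_satakePow (μ := μ) :=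
  summable_normSq_trace_satakePow_of_norm_le_one (norm_le_one_of_ramanujan hR)

/-- Ramanujan implies (5.1.3) (`norm_satakeParameter_le_sqrt`). [folklore] -/
theorem norm_satakeParameter_le_sqrt_of_ramanujan (hR : Literature.NumberTheory.Automorphic.RamanujanConjectureGL n) :
    norm_satakeParameter_le_sqrt (μ := μ) :=
  norm_satakeParameter_le_sqrt_of_norm_le_one (norm_le_one_of_ramanujan hR)

/-- Ramanujan implies the conclusion of Jacquet–Shalika's Lemma (5.2)
(`JacquetShalika1981_continuation_partialPairL_conj`), with the Euler product as its own
continuation. [folklore] -/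
theorem continuation_partialPairL_conj_of_ramanujan (hR : Literature.NumberTheory.Automorphic.RamanujanConjectureGL n) :
    JacquetShalika1981_continuation_partialPairL_conj (μ := μ) :=
  continuation_partialPairL_conj_of_norm_le_one (norm_le_one_of_ramanujan hR)

/-- Ramanujan implies `L_eq_partialStandardL_mul`. [folklore] -/
theorem StandardLFunctionData.L_eq_partialStandardL_mul_of_ramanujan
    (hR : Literature.NumberTheory.Automorphic.RamanujanConjectureGL n) {P : CuspidalAutomorphicRepGL n K μ} :
    StandardLFunctionData.L_eq_partialStandardL_mul (P := P) :=
  StandardLFunctionData.L_eq_partialStandardL_mul_of_norm_le_one (norm_le_one_of_ramanujan hR)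

end Ramanujan

/-! ### Rank `≤ 1`: Hecke operators are single translations, and the unit bound holds -/

section Commutative

/-- Invertible matrices over a commutative ring indexed by a subsingleton type commute
(`GL_1(R) = Rˣ`, `GL_0(R) = 1`). [folklore] -/
theorem gl_mul_comm_of_subsingleton {m : Type*} [Fintype m] [DecidableEq m] [Subsingleton m]
    {R : Type*} [CommRing R] (g h : GL m R) : g * h = h * g := by
  refine Units.ext (Matrix.ext fun i j => ?_)
  obtain rfl : j = i := Subsingleton.elim _ _
  simp only [Units.val_mul, Matrix.mul_apply, Fintype.sum_subsingleton _ j]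
  exact mul_comm _ _

/-- In a commutative situation the `K`-orbit of the coset `gK` in `G ⧸ K` is the single point
`gK` (`k g K = g k K = g K`), so the double coset `K g K` is the single coset `g K`. [folklore] -/
theorem orbit_mk_eq_singleton_of_subsingleton {m : Type*} [Fintype m] [DecidableEq m]
    [Subsingleton m] {R : Type*} [CommRing R] (Kf : Subgroup (GL m R)) (g : GL m R) :
    MulAction.orbit Kf (g : GL m R ⧸ Kf) = {(g : GL m R ⧸ Kf)} := by
  ext y
  simp only [Set.mem_singleton_iff, MulAction.mem_orbit_iff]
  constructor
  · rintro ⟨k, rfl⟩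
    show (((k : GL m R) * g : GL m R) : GL m R ⧸ Kf) = (g : GL m R ⧸ Kf)
    rw [gl_mul_comm_of_subsingleton, QuotientGroup.mk_mul_of_mem g k.2]
  · rintro rfl
    exact MulAction.mem_orbit_self _

end Commutative

section RankLeOneHecke

variable {n : ℕ} {K : Type} [Field K] [NumberField K]
  {μ : Measure (AdelicGroupData.gl n K).automorphicQuotient}
  [SMulInvariantMeasure (AdelicGroupData.gl n K).Adelic (AdelicGroupData.gl n K).automorphicQuotient μ]

/-- **In rank `≤ 1` every Hecke eigenvalue has absolute value `1`.** For `n ≤ 1` the group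
`GL_n(𝔸_K)` is commutative, so for any level `Kf` and any `g` the double coset `Kf g Kf` is the
single coset `g Kf` and the Hecke operator `[Kf g Kf]` acts on a `Kf`-fixed `f ∈ W ≤ L²` as the
single translation `R(g)`, an isometry of `L²` (`norm_toContRep_apply`); hence
`[Kf g Kf] f = c • f`, `f ≠ 0`, forces `|c| = 1`. [folklore] -/
theorem norm_eq_one_of_heckeOperatorAt_apply_eq_smul [Subsingleton (Fin n)]
    (W : ContRepresentation.ClosedSubrep ((AdelicGroupData.gl n K).rightRegular μ))
    (Kf : Subgroup (GL (Fin n) (AdeleRing (𝓞 K) K))) (g : GL (Fin n) (AdeleRing (𝓞 K) K))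
    {f : W.toSubmodule} (hfK : f ∈ W.fixedVectors Kf) (hf0 : f ≠ 0) {c : ℂ}
    (h : heckeOperatorAt W Kf g f = c • f) : ‖c‖ = 1 := by
  have hsum : heckeOperatorAt W Kf g f = W.toContRep g f := by
    have hbij : Set.BijOn (fun x : GL (Fin n) (AdeleRing (𝓞 K) K) => (x : _ ⧸ Kf))
        ({g} : Finset (GL (Fin n) (AdeleRing (𝓞 K) K))) (MulAction.orbit Kf (g : _ ⧸ Kf)) := by
      rw [Finset.coe_singleton, orbit_mk_eq_singleton_of_subsingleton]
      exact Set.bijOn_singleton.mpr rfl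
    have := heckeOperator_apply_eq_sum W.toContRep.toRepresentation Kf g {g} hbij hfK
    erw [Finset.sum_singleton] at this
    exact this
  have h1 : ‖c‖ * ‖f‖ = ‖f‖ := by
    rw [← norm_smul, ← h, hsum, norm_toContRep_apply]
  exact (mul_eq_right₀ (norm_ne_zero_iff.mpr hf0)).mp h1

/-- **In rank `≤ 1` Hecke–Satake parameters have absolute value `1`** (for *any* level `Kf`):
for `n = 0` the parameter is empty; for `n = 1`, `α = {a}` and `HasSatakeParameterAt` records
`T_{v,1} f = q_v^0 e_1(α) f = a f` for a non-zero `Kf`-fixed `f`, so `|a| = 1` by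
`norm_eq_one_of_heckeOperatorAt_apply_eq_smul`. (For `n = 1` this is the unitarity
`|χ_v(ϖ_v)| = 1` of the local components of a Hecke character `χ` of `𝔸_K^× / K^× ℝ_{>0}`, the
parameter being `χ_v(ϖ_v)^{±1}` according to the `rightRegular` convention.) [folklore] -/
theorem norm_eq_one_of_hasSatakeParameterAt_of_le_one (hn : n ≤ 1)
    {W : ContRepresentation.ClosedSubrep ((AdelicGroupData.gl n K).rightRegular μ)}
    {Kf : Subgroup (GL (Fin n) (AdeleRing (𝓞 K) K))} {v : HeightOneSpectrum (𝓞 K)}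
    {ϖ : (v.adicCompletion K)ˣ} {α : Multiset ℂ} (h : HasSatakeParameterAt W Kf v ϖ α)
    {a : ℂ} (ha : a ∈ α) : ‖a‖ = 1 := by
  obtain ⟨-, hcard, f, hfK, hf0, heig⟩ := h
  rcases Nat.le_one_iff_eq_zero_or_eq_one.mp hn with rfl | rfl
  · rw [Multiset.card_eq_zero] at hcard
    subst hcard
    exact absurd ha (Multiset.notMem_zero a)
  · obtain ⟨b, rfl⟩ := Multiset.card_eq_one.mp hcard
    rw [Multiset.mem_singleton] at ha
    subst ha
    have h1 := heig 1 le_rfl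
    have he : ({a} : Multiset ℂ).esymm 1 = a := by
      simp [Multiset.esymm, Multiset.powersetCard_one]
    rw [he] at h1
    simp only [Nat.sub_self, mul_zero, pow_zero, one_mul] at h1
    exact norm_eq_one_of_heckeOperatorAt_apply_eq_smul W Kf _ hfK hf0 h1

end RankLeOneHecke

section RankLeOneCuspidal

variable {n : ℕ} {K : Type} [Field K] [NumberField K]
  {μ : Measure (AdelicGroupData.gl n K).automorphicQuotient}
  [(AdelicGroupData.gl n K).IsAutomorphicMeasure μ]

/-- **Clause (i) of the Ramanujan conjecture holds in rank `≤ 1`:** for every cuspidal `Π` of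
`GL_n(𝔸_K)`, `n ≤ 1`, every level `Kf` (maximality at `v` is not even needed), every finite place
`v`, uniformizer `ϖ` and Satake parameter `α` of `Π` at `v`, all `a ∈ α` have `|a| = 1`
(`norm_eq_one_of_hasSatakeParameterAt_of_le_one`). This is the first conjunct of
`Literature.Lang.RamanujanConjectureGL n` for `n ≤ 1`; the second (temperedness of local components) is
not addressed here. [folklore] -/
theorem ramanujan_bound_of_le_one (hn : n ≤ 1) (P : CuspidalAutomorphicRepGL n K μ)
    (Kf : Subgroup (AdelicGroupData.gl n K).Adelic) (v : HeightOneSpectrum (𝓞 K))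
    (ϖ : (v.adicCompletion K)ˣ) (α : Multiset ℂ) (_hmax : IsMaximalAt n K v Kf)
    (h : HasSatakeParameterAt P.1 Kf v ϖ α) : ∀ a ∈ α, ‖a‖ = 1 :=
  fun _ ha => norm_eq_one_of_hasSatakeParameterAt_of_le_one hn h ha

/-- In rank `≤ 1` every member of a Satake family of a cuspidal `Π` off `S` has absolute value `1`.
[folklore] -/
theorem IsSatakeFamilyOf.norm_eq_one_of_le_one (hn : n ≤ 1) {P : CuspidalAutomorphicRepGL n K μ}
    {S : Set (HeightOneSpectrum (𝓞 K))} {α : SatakeFamily K} (hα : IsSatakeFamilyOf P S α)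
    {v : HeightOneSpectrum (𝓞 K)} (hv : v ∉ S) {a : ℂ} (ha : a ∈ α v) : ‖a‖ = 1 := by
  obtain ⟨𝔫, -, -, ϖ, hsat⟩ := hα v hv
  exact norm_eq_one_of_hasSatakeParameterAt_of_le_one hn hsat ha

/-- In rank `≤ 1` all Satake families of all cuspidal `Π` satisfy the unit bound. [folklore] -/
theorem norm_le_one_of_le_one (hn : n ≤ 1) :
    ∀ (P : CuspidalAutomorphicRepGL n K μ) ⦃S : Set (HeightOneSpectrum (𝓞 K))⦄
      ⦃α : SatakeFamily K⦄, IsSatakeFamilyOf P S α → ∀ v ∉ S, ∀ a ∈ α v, ‖a‖ ≤ 1 :=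
  fun _ _ _ hα _ hv _ ha => (hα.norm_eq_one_of_le_one hn hv ha).le

/-- **`multipliable_L` holds unconditionally in rank `≤ 1`:** for every cuspidal automorphic
representation `Π` of `GL_n(𝔸_K)`, `n ≤ 1` (i.e. `n = 1`: the unitary Hecke characters of
`𝔸_K^× / K^× ℝ_{>0}`; and the trivial case `n = 0`), the full Euler product of every standard
`L`-function datum of `Π` is multipliable on `re s > 1` — the named fact
`StandardLFunctionData.multipliable_L`, **proved** for `n ≤ 1` (the Hecke `L`-function
`L(s, χ) = ∏_v (1 - χ_v(ϖ_v) q_v^{-s})⁻¹` converges absolutely on `re s > 1` because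
`|χ_v(ϖ_v)| = 1`; classical, Hecke / Tate's thesis). [folklore] -/
theorem StandardLFunctionData.multipliable_L_of_le_one (hn : n ≤ 1)
    {P : CuspidalAutomorphicRepGL n K μ} : StandardLFunctionData.multipliable_L (P := P) :=
  StandardLFunctionData.multipliable_L_of_norm_le_one fun _ _ hα => norm_le_one_of_le_one hn P hα

/-- `multipliable_partialStandardL` holds unconditionally in rank `≤ 1`. [folklore] -/
theorem multipliable_partialStandardL_of_le_one (hn : n ≤ 1) :
    multipliable_partialStandardL (n := n) (μ := μ) :=
  multipliable_partialStandardL_of_norm_le_one (norm_le_one_of_le_one hn)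

/-- `absolutelyConvergent_partialStandardL` holds unconditionally in rank `≤ 1`. [folklore] -/
theorem absolutelyConvergent_partialStandardL_of_le_one (hn : n ≤ 1) :
    absolutelyConvergent_partialStandardL (n := n) (μ := μ) :=
  absolutelyConvergent_partialStandardL_of_norm_le_one (norm_le_one_of_le_one hn)

/-- (5.3.3)–(5.3.4) (`summable_normSq_trace_satakePow`) holds unconditionally in rank `≤ 1`.
[folklore] -/
theorem summable_normSq_trace_satakePow_of_le_one (hn : n ≤ 1) :
    summable_normSq_trace_satakePow (n := n) (μ := μ) :=
  summable_normSq_trace_satakePow_of_norm_le_one (norm_le_one_of_le_one hn)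

/-- (5.1.3) (`norm_satakeParameter_le_sqrt`) holds unconditionally in rank `≤ 1`. [folklore] -/
theorem norm_satakeParameter_le_sqrt_of_le_one (hn : n ≤ 1) :
    norm_satakeParameter_le_sqrt (n := n) (μ := μ) :=
  norm_satakeParameter_le_sqrt_of_norm_le_one (norm_le_one_of_le_one hn)

/-- **Jacquet–Shalika's Lemma (5.2) holds unconditionally in rank `≤ 1`**
(`JacquetShalika1981_continuation_partialPairL_conj` for `n ≤ 1`): `L_S(s, χ × χ̄) = ζ_{K,S}(s)`
is its own continuation, holomorphic on `re s > 1`. [folklore] -/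
theorem continuation_partialPairL_conj_of_le_one (hn : n ≤ 1) :
    JacquetShalika1981_continuation_partialPairL_conj (n := n) (μ := μ) :=
  continuation_partialPairL_conj_of_norm_le_one (norm_le_one_of_le_one hn)

/-- `L_eq_partialStandardL_mul` holds unconditionally in rank `≤ 1`. [folklore] -/
theorem StandardLFunctionData.L_eq_partialStandardL_mul_of_le_one (hn : n ≤ 1)
    {P : CuspidalAutomorphicRepGL n K μ} :
    StandardLFunctionData.L_eq_partialStandardL_mul (P := P) :=
  StandardLFunctionData.L_eq_partialStandardL_mul_of_norm_le_one (norm_le_one_of_le_one hn)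

end RankLeOneCuspidal

end Literature.NumberTheory.Automorphic
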